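import Summits.QuantumFields.BalabanUV.T4Continuum.Support.NE7PairwiseL1Junction
import Summits.QuantumFields.BalabanUV.T4Continuum.Support.NE7MarginalL1Supply
import Summits.QuantumFields.BalabanUV.T4Continuum.Support.NE7PairwiseTower

/-!
# NE7PairwiseL1Sources — row NE7 (node U5), route «PAIR-CAUCHY»'s marginal channel FROM ONE-STEP SOURCES, BY NAME:
# route ℓ¹'s supplier side (`NE7MarginalL1Supply`: BV one-loop coefficients + summable one-step sources + fading memories
# ⇒ a summable along-run β-shift) composed with the junction «ℓ¹ ⟹ null» (`NE7PairwiseL1Junction`) gives the PAIRWISE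
# coupling gap null for every offset sequence and pairwise-uniformly — with NO node-U5 hypothesis — and feeds NODE T♭

Cell `pub-balaban`, rung (B)+1 sub-cell t4, lineage `b2b-balaban-t4-ne7-p2` (CRUX PROVER NE7 #2 under the coordinator
ruling «YM redirect» e34b3e0c, 2026-08-21; generation 60; route text `HOME/t4/b2b-balaban-t4-ne7-p2/g60/ROUTE2-NE7-P2.md`
v1.14 §2 T.5♭ ∕ §17).  HONEST FRAMING (page 1): FIXED FINITE T⁴, rung (B)+1 = existence AND uniqueness of the
`ε = L^{−K} → 0` limit of unit-scale averaged expectations, CONDITIONAL on BetaPertH and the nine spine estimates (0/9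
proved); NOT infinite volume, NOT a mass gap, NOT the Clay problem.  NE7 is NOT PRINTED in
[Balaban1984PropagatorsI]–[Balaban1989LargeFieldII] and NOT proved here.  Everything below is [folklore] composition BY
NAME of tree theorems over the tree's hypothesis SHAPES; 0 definitions, no cite tag of our own, nothing printed asserted,
no `sorry`.

WHY.  Route ℓ¹ (rank 1 → t4-ne7-p1) now has FIVE modules; its `NE7MarginalL1Assembly.u6_of_sources_fadingMemory`
(p273989, §4) types the δ-road's U2 → U6 segment END-TO-END from ONE-STEP inputs: the printed one-loop split
`S : B12Beta.OneLoopSplit β` with BV one-loop coefficients `|β⁰_{k+1} − β⁰_k| ≤ σ⁰_k`, `Σσ⁰ < ∞`; the remainder's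
`T4BetaMemory.ShiftDecomposition S γ src M s` and `DataRenewal src′ M′ s` with SUMMABLE one-step sources and memories
fading at rate `ω`, `(1+C′)ω < 1`; history moduli `HistLipschitz Λ γ β` with `FadingMemory C ω Λ`; IR-pinned
eventually-AF runs with the smallness `C((k₀+1)γ³ + 2γ∕b) ≤ (1−ω)∕2`; AND node U5 (`MatchingModConstants`, hypothesised).
Generation 59 of this lineage docked route «PAIR-CAUCHY» to route ℓ¹'s RUN side (`NE7PairwiseL1Junction.couplingGap_*_of_
shiftAlong_fadingMemory`: `ShiftAlongRun σ` along every run + `Σσ < ∞` ⇒ the pairwise coupling gap is null).  This file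
docks one level lower, to the SAME one-step source list as P1's §4: route ℓ¹'s supplier theorems
`NE7MarginalL1Supply.remainderShift_l1_of_memory` + `shiftAlong_of_split_l1` produce the summable along-run shift (§1,
packaged), and g59's junction turns it into route «PAIR-CAUCHY»'s marginal-channel input (§2): for every block scale `m`
and EVERY offset sequence `n`, `|1∕(g K (K−m))² − 1∕(g (K+n K) (K−m+n K))²| → 0` (= `NE7PairwiseCouplingDock.
couplingGap_tendsto_zero`'s conclusion p249585 = NODE T♭'s `hd`), and the pairwise-UNIFORM form of
`NE7PairwiseCouplingUniform.couplingGap_uniform` (p250419).  THE POINT OF RECORD: on route «PAIR-CAUCHY» the marginal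
channel closes from the one-step source list WITHOUT node U5 — the coupling-gap level sits below U5, which this route
replaces downstream by pair matching (`NE7PairwiseCauchy`, `NE7PairwiseOffsetEnd`); P1's U6 assembly carries `hU5` because
it exits at U6.  §3 feeds NODE T♭ (`NE7PairwiseTower.termModulus_tendsto_zero`) with this marginal channel: along any offset
sequence the two-run TERM modulus is null per block scale as soon as the creation, background and history channels are
(rows NE5♭ ∕ NE3♭ ∕ NE9 in null currency — route text §2 T.3♭ ∕ T.4♭ ∕ T.1♭), the marginal channel being supplied here.

WHAT IS PROVED ([folklore]).
§1 **`exists_summable_shiftAlong_of_sources`** — one-step sources ⇒ `∃ σ ≥ 0`, `Summable σ`, `ShiftAlongRun σ β (g (K+1)) K`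
   for every `K` (route ℓ¹'s supplier output, packaged; `σ = σ⁰ + src + Σ_{i<k} M_{k,i}s_i`).
§2 **`couplingGap_tendsto_zero_of_sources_fadingMemory`** (every offset sequence), **`couplingGap_uniform_of_sources_
   fadingMemory`** (pairwise-uniform), `couplingGap_tendsto_zero_of_sources_lastOnly` (last-only feedback regime) — the
   binders are P1's `u6_of_sources_fadingMemory`'s MINUS `hE hρ0 hρ1 hl₀ hU5` (no contraction `ρ`, no `E`, no `Z`, no U5).
§3 **`termModulus_tendsto_zero_of_sources`** — NODE T♭'s conclusion `∀ m, T K m → 0` along an offset sequence, with the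
   marginal channel `d K m := |1∕(g K (K−m))² − 1∕(g (K+n K) (K−m+n K))²|` discharged from the one-step sources and the
   other three channels hypothesised in NODE T♭'s own shapes.

NOT DELIVERED ∕ HONEST: removes NO input by name — `Σσ⁰ < ∞` (BV of the per-depth one-loop coefficients: the β-cell's
question, rider LÖW-b₀(k)), `Σ src < ∞`, `Σ src′ < ∞` (rows NE2∕NE3∕NE5 in ℓ¹ currency), the memories (NE9), the AF window
and the IR-pinned run family are UNPRINTED hypotheses exactly as in P1's §4; `σ` is produced FROM them, not from print;
nothing of [Balaban1987RG1]'s (1.22); NODE O untouched; NOT NE7 (spine 0/9 unchanged), NOT summit progress.  HONEST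
DEPENDENCY: continuum YM on T⁴ ⇐ BetaPertH ∧ nine spine estimates (0/9 proved); BetaPertH ⇐ (D1) ∧ (D4) ∧ CAP+tail;
G-an2-4 gates asym, D1 and NE2/3/4.
-/

noncomputable section

open Finset Filter Topology
open scoped BigOperators

namespace Summit.QuantumFields.BalabanUV.T4Continuum.NE7PairwiseL1Sources

open Literature.MathematicalPhysics.QuantumFieldTheory.Balaban1983to89
open Literature.MathematicalPhysics.QuantumFieldTheory.Balaban1983to89.FlowStep
open Literature.MathematicalPhysics.QuantumFieldTheory.Balaban1983to89.T4CouplingMatching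
open T4BetaMemory (ShiftDecomposition DataRenewal)
open NE7MarginalL1Currency (ShiftAlongRun)
open NE7MarginalL1Supply (remainderShift_l1_of_memory shiftAlong_of_split_l1)
open NE7PairwiseL1Junction

/-! ## §1 Route ℓ¹'s supplier output, packaged -/

/-- **ONE-STEP SOURCES ⇒ A SUMMABLE ALONG-RUN SHIFT (route ℓ¹'s supplier side, packaged).**  GIVEN the printed one-loop
split `S` with BV one-loop coefficients `|β⁰_{k+1} − β⁰_k| ≤ σ⁰_k`, `Σσ⁰ < ∞`; the remainder's `ShiftDecomposition S γ src M s`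
and `DataRenewal src′ M′ s` with nonnegative SUMMABLE one-step sources and memories `FadingMemory C_M ω M`,
`FadingMemory C′ ω M′`, `0 ≤ ω`, `(1+C′)ω < 1`; and a family of runs `g` living in the box `]0, γ]`: THEN there is ONE
nonnegative summable `σ` (namely `σ⁰_k + src k + Σ_{i<k} M_{k,i}s_i`) with `ShiftAlongRun σ β (g (K+1)) K` for every `K`.
Composition of `NE7MarginalL1Supply.remainderShift_l1_of_memory` and `shiftAlong_of_split_l1`; every hypothesis UNPRINTED.
[folklore] -/
theorem exists_summable_shiftAlong_of_sources {β : HBeta} (S : B12Beta.OneLoopSplit β) {γ ω C_M C' : ℝ}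
    {M M' : ℕ → ℕ → ℝ} {σ0 src src' s : ℕ → ℝ} (g : ℕ → ℕ → ℝ)
    (hω0 : 0 ≤ ω) (hCM : 0 ≤ C_M) (hC' : 0 ≤ C') (hsmallω : (1 + C') * ω < 1)
    (h0 : ∀ k, |S.β0 (k + 1) - S.β0 k| ≤ σ0 k) (hs0 : Summable σ0)
    (hdec : ShiftDecomposition S γ src M s) (hren : DataRenewal src' M' s)
    (hM : FadingMemory C_M ω M) (hM' : FadingMemory C' ω M')
    (hs : ∀ i, 0 ≤ s i) (hsrc0 : ∀ k, 0 ≤ src k) (hsrc'0 : ∀ j, 0 ≤ src' j)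
    (hsrc : Summable src) (hsrc' : Summable src')
    (hbox : ∀ K i, i ≤ K → 0 < g K i ∧ g K i ≤ γ) :
    ∃ σ : ℕ → ℝ, (∀ j, 0 ≤ σ j) ∧ Summable σ ∧ ∀ K, ShiftAlongRun σ β (g (K + 1)) K := by
  obtain ⟨hσ1nn, hσ1sum, hσ1box⟩ :=
    remainderShift_l1_of_memory hCM hC' hω0 hsmallω hdec hren hM hM' hs hsrc0 hsrc'0 hsrc hsrc'
  refine ⟨fun j => σ0 j + (src j + ∑ i ∈ range j, M j i * s i),
    fun j => add_nonneg ((abs_nonneg _).trans (h0 j)) (hσ1nn j), hs0.add hσ1sum, fun K => ?_⟩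
  exact (shiftAlong_of_split_l1 S (σ1 := fun j => src j + ∑ i ∈ range j, M j i * s i) h0 hσ1box
    (hbox (K + 1))).1

/-! ## §2 The pairwise coupling gap from one-step sources — no node U5 -/

/-- **ONE-STEP SOURCES ⇒ THE PAIRWISE COUPLING GAP IS NULL, EVERY OFFSET SEQUENCE (fading-memory feedback).**  The binders
are those of route ℓ¹'s `NE7MarginalL1Assembly.u6_of_sources_fadingMemory` MINUS `hE`, `hρ0`, `hρ1`, `hl₀`, `hU5` (no
contraction, no generating functions, NO node U5): one-loop split with BV coefficients, summable one-step sources with fading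
memories, history moduli `HistLipschitz Λ γ β` + `FadingMemory C ω Λ`, IR-pinned eventually-AF runs of (0.20) in the box,
smallness `C((k₀+1)γ³ + 2γ∕b) ≤ (1−ω)∕2`.  THEN for every offset sequence `n` and every block scale `m`,
`|1∕(g K (K−m))² − 1∕(g (K+n K) (K−m+n K))²| → 0` — `NE7PairwiseCouplingDock.couplingGap_tendsto_zero`'s conclusion, NODE
T♭'s `hd`.  §1 ∘ `NE7PairwiseL1Junction.couplingGap_tendsto_zero_of_shiftAlong_fadingMemory`. [folklore] -/
theorem couplingGap_tendsto_zero_of_sources_fadingMemory {β : HBeta} (S : B12Beta.OneLoopSplit β)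
    {γ b ω C C_M C' : ℝ} {Λ M M' : ℕ → ℕ → ℝ} {σ0 src src' s : ℕ → ℝ} {k₀ : ℕ}
    (g : ℕ → ℕ → ℝ) (gIR : ℝ) (n : ℕ → ℕ)
    (hγ : 0 < γ) (hb : 0 < b) (hω0 : 0 < ω) (hω1 : ω < 1) (hC : 0 ≤ C) (hCM : 0 ≤ C_M) (hC' : 0 ≤ C')
    (hsmallω : (1 + C') * ω < 1)
    (h0 : ∀ k, |S.β0 (k + 1) - S.β0 k| ≤ σ0 k) (hs0 : Summable σ0)
    (hdec : ShiftDecomposition S γ src M s) (hren : DataRenewal src' M' s)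
    (hM : FadingMemory C_M ω M) (hM' : FadingMemory C' ω M')
    (hs : ∀ i, 0 ≤ s i) (hsrc0 : ∀ k, 0 ≤ src k) (hsrc'0 : ∀ j, 0 ≤ src' j)
    (hsrc : Summable src) (hsrc' : Summable src')
    (hrun : ∀ K, RGEqH K β (g K)) (hbox : ∀ K i, i ≤ K → 0 < g K i ∧ g K i ≤ γ) (hpin : ∀ K, g K K = gIR)
    (hL : HistLipschitz Λ γ β) (hΛ : FadingMemory C ω Λ) (hlo : EventualLowerH b γ k₀ β)
    (hsmall : C * (((k₀ : ℝ) + 1) * γ ^ 3 + 2 * γ / b) ≤ (1 - ω) / 2) :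
    ∀ m, Tendsto (fun K => |1 / (g K (K - m)) ^ 2 - 1 / (g (K + n K) (K - m + n K)) ^ 2|) atTop (𝓝 0) := by
  obtain ⟨σ, hσ0, hσs, hS⟩ := exists_summable_shiftAlong_of_sources S g hω0.le hCM hC' hsmallω h0 hs0 hdec hren hM
    hM' hs hsrc0 hsrc'0 hsrc hsrc' hbox
  exact couplingGap_tendsto_zero_of_shiftAlong_fadingMemory g gIR n hγ hb hω0 hω1 hC hσ0 hσs hrun hbox hpin
    (fun K j hj => hS K j hj) hL hΛ hlo hsmall

/-- **ONE-STEP SOURCES ⇒ THE PAIRWISE COUPLING GAP IS NULL, UNIFORMLY IN THE FINER RUN.**  Same binders; conclusion in the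
shape of `NE7PairwiseCouplingUniform.couplingGap_uniform` (p250419): `∀ m, ∀ ε > 0, ∃ K₀, ∀ K₀ ≤ K ≤ K′,
|1∕(g K (K−m))² − 1∕(g K′ (K′−m))²| < ε`.  §1 ∘ `NE7PairwiseL1Junction.couplingGap_uniform_of_shiftAlong_fadingMemory`
(directly, no diagonal argument). [folklore] -/
theorem couplingGap_uniform_of_sources_fadingMemory {β : HBeta} (S : B12Beta.OneLoopSplit β)
    {γ b ω C C_M C' : ℝ} {Λ M M' : ℕ → ℕ → ℝ} {σ0 src src' s : ℕ → ℝ} {k₀ : ℕ}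
    (g : ℕ → ℕ → ℝ) (gIR : ℝ)
    (hγ : 0 < γ) (hb : 0 < b) (hω0 : 0 < ω) (hω1 : ω < 1) (hC : 0 ≤ C) (hCM : 0 ≤ C_M) (hC' : 0 ≤ C')
    (hsmallω : (1 + C') * ω < 1)
    (h0 : ∀ k, |S.β0 (k + 1) - S.β0 k| ≤ σ0 k) (hs0 : Summable σ0)
    (hdec : ShiftDecomposition S γ src M s) (hren : DataRenewal src' M' s)
    (hM : FadingMemory C_M ω M) (hM' : FadingMemory C' ω M')
    (hs : ∀ i, 0 ≤ s i) (hsrc0 : ∀ k, 0 ≤ src k) (hsrc'0 : ∀ j, 0 ≤ src' j)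
    (hsrc : Summable src) (hsrc' : Summable src')
    (hrun : ∀ K, RGEqH K β (g K)) (hbox : ∀ K i, i ≤ K → 0 < g K i ∧ g K i ≤ γ) (hpin : ∀ K, g K K = gIR)
    (hL : HistLipschitz Λ γ β) (hΛ : FadingMemory C ω Λ) (hlo : EventualLowerH b γ k₀ β)
    (hsmall : C * (((k₀ : ℝ) + 1) * γ ^ 3 + 2 * γ / b) ≤ (1 - ω) / 2) :
    ∀ m : ℕ, ∀ ε : ℝ, 0 < ε → ∃ K₀ : ℕ, ∀ K K' : ℕ, K₀ ≤ K → K ≤ K' →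
      |1 / (g K (K - m)) ^ 2 - 1 / (g K' (K' - m)) ^ 2| < ε := by
  obtain ⟨σ, hσ0, hσs, hS⟩ := exists_summable_shiftAlong_of_sources S g hω0.le hCM hC' hsmallω h0 hs0 hdec hren hM
    hM' hs hsrc0 hsrc'0 hsrc hsrc' hbox
  exact couplingGap_uniform_of_shiftAlong_fadingMemory g gIR hγ hb hω0 hω1 hC hσ0 hσs hrun hbox hpin
    (fun K j hj => hS K j hj) hL hΛ hlo hsmall

/-- **ONE-STEP SOURCES ⇒ THE PAIRWISE COUPLING GAP IS NULL (LAST-ONLY feedback regime).**  The one-step source list as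
above (memories of the REMAINDER fading at some rate `ω ≥ 0` with `(1+C′)ω < 1`), but the feedback of β on the history is
last-only: `LastOnlyLipschitz L γ β` with `L·γ³ ≤ 1∕2`; IR-pinned eventually-AF runs in the box.  THEN the pairwise coupling
gap is null along every offset sequence.  §1 ∘ `NE7PairwiseL1Junction.couplingGap_tendsto_zero_of_shiftAlong_lastOnly`.
[folklore] -/
theorem couplingGap_tendsto_zero_of_sources_lastOnly {β : HBeta} (S : B12Beta.OneLoopSplit β)
    {γ b L ω C_M C' : ℝ} {M M' : ℕ → ℕ → ℝ} {σ0 src src' s : ℕ → ℝ} {k₀ : ℕ}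
    (g : ℕ → ℕ → ℝ) (gIR : ℝ) (n : ℕ → ℕ)
    (hγ : 0 < γ) (hb : 0 < b) (hL0 : 0 ≤ L) (hLγ : L * γ ^ 3 ≤ 1 / 2) (hω0 : 0 ≤ ω) (hCM : 0 ≤ C_M)
    (hC' : 0 ≤ C') (hsmallω : (1 + C') * ω < 1)
    (h0 : ∀ k, |S.β0 (k + 1) - S.β0 k| ≤ σ0 k) (hs0 : Summable σ0)
    (hdec : ShiftDecomposition S γ src M s) (hren : DataRenewal src' M' s)
    (hM : FadingMemory C_M ω M) (hM' : FadingMemory C' ω M')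
    (hs : ∀ i, 0 ≤ s i) (hsrc0 : ∀ k, 0 ≤ src k) (hsrc'0 : ∀ j, 0 ≤ src' j)
    (hsrc : Summable src) (hsrc' : Summable src')
    (hrun : ∀ K, RGEqH K β (g K)) (hbox : ∀ K i, i ≤ K → 0 < g K i ∧ g K i ≤ γ) (hpin : ∀ K, g K K = gIR)
    (hLip : LastOnlyLipschitz L γ β) (hlo : EventualLowerH b γ k₀ β) :
    ∀ m, Tendsto (fun K => |1 / (g K (K - m)) ^ 2 - 1 / (g (K + n K) (K - m + n K)) ^ 2|) atTop (𝓝 0) := by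
  obtain ⟨σ, hσ0, hσs, hS⟩ := exists_summable_shiftAlong_of_sources S g hω0 hCM hC' hsmallω h0 hs0 hdec hren hM
    hM' hs hsrc0 hsrc'0 hsrc hsrc' hbox
  exact couplingGap_tendsto_zero_of_shiftAlong_lastOnly g gIR n hγ hb hL0 hLγ hσ0 hσs hrun hbox hpin
    (fun K j hj => hS K j hj) hLip hlo

/-! ## §3 NODE T♭ with the marginal channel supplied from one-step sources -/

/-- **NODE T♭ ALONG AN OFFSET SEQUENCE, MARGINAL CHANNEL DISCHARGED FROM ONE-STEP SOURCES.**  Fix an offset sequence `n`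
(finer partner `K + n K`).  If the two-run TERM modulus `T K m` of a term born at block scale `m` obeys NODE T♭'s shape
`T K m ≤ ω₅ K m + CU·ω₃ K m + C₉·Σ_{a ≤ K−m} ν^a·u m (K−m−a) + Cd·|1∕(g K (K−m))² − 1∕(g (K+n K) (K−m+n K))²|` (`m ≤ K`;
creation, background, history and MARGINAL channels; `NE7PairwiseTower.termModulus_tendsto_zero`), with the creation and
background channels null per block scale (rows NE5♭, NE3♭), the history inputs bounded and null (row NE9's memory weights,
`0 ≤ ν < 1`), THEN — the marginal channel being null by §2 from the one-step source list — `T K m → 0` for every `m`.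
[folklore] -/
theorem termModulus_tendsto_zero_of_sources {β : HBeta} (S : B12Beta.OneLoopSplit β)
    {γ b ω C C_M C' : ℝ} {Λ M M' : ℕ → ℕ → ℝ} {σ0 src src' s : ℕ → ℝ} {k₀ : ℕ}
    (g : ℕ → ℕ → ℝ) (gIR : ℝ) (n : ℕ → ℕ)
    (hγ : 0 < γ) (hb : 0 < b) (hω0 : 0 < ω) (hω1 : ω < 1) (hC : 0 ≤ C) (hCM : 0 ≤ C_M) (hC' : 0 ≤ C')
    (hsmallω : (1 + C') * ω < 1)
    (h0 : ∀ k, |S.β0 (k + 1) - S.β0 k| ≤ σ0 k) (hs0 : Summable σ0)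
    (hdec : ShiftDecomposition S γ src M s) (hren : DataRenewal src' M' s)
    (hM : FadingMemory C_M ω M) (hM' : FadingMemory C' ω M')
    (hs : ∀ i, 0 ≤ s i) (hsrc0 : ∀ k, 0 ≤ src k) (hsrc'0 : ∀ j, 0 ≤ src' j)
    (hsrc : Summable src) (hsrc' : Summable src')
    (hrun : ∀ K, RGEqH K β (g K)) (hbox : ∀ K i, i ≤ K → 0 < g K i ∧ g K i ≤ γ) (hpin : ∀ K, g K K = gIR)
    (hL : HistLipschitz Λ γ β) (hΛ : FadingMemory C ω Λ) (hlo : EventualLowerH b γ k₀ β)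
    (hsmall : C * (((k₀ : ℝ) + 1) * γ ^ 3 + 2 * γ / b) ≤ (1 - ω) / 2)
    {ν CU C₉ Cd U : ℝ} {T ω₅ ω₃ : ℕ → ℕ → ℝ} {u : ℕ → ℕ → ℝ} (hν0 : 0 ≤ ν) (hν1 : ν < 1)
    (hT : ∀ K m, m ≤ K → T K m ≤ ω₅ K m + CU * ω₃ K m
      + C₉ * ∑ a ∈ range (K - m + 1), ν ^ a * u m (K - m - a)
      + Cd * |1 / (g K (K - m)) ^ 2 - 1 / (g (K + n K) (K - m + n K)) ^ 2|)
    (hT0 : ∀ K m, 0 ≤ T K m)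
    (h5 : ∀ m, Tendsto (fun K => ω₅ K m) atTop (𝓝 0)) (h3 : ∀ m, Tendsto (fun K => ω₃ K m) atTop (𝓝 0))
    (hu : ∀ m a, |u m a| ≤ U) (hu0 : ∀ m, Tendsto (u m) atTop (𝓝 0)) :
    ∀ m, Tendsto (fun K => T K m) atTop (𝓝 0) :=
  NE7PairwiseTower.termModulus_tendsto_zero
    (d := fun K m => |1 / (g K (K - m)) ^ 2 - 1 / (g (K + n K) (K - m + n K)) ^ 2|)
    hν0 hν1 hT hT0 h5 h3 hu hu0
    (couplingGap_tendsto_zero_of_sources_fadingMemory S g gIR n hγ hb hω0 hω1 hC hCM hC' hsmallω h0 hs0 hdec hren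
      hM hM' hs hsrc0 hsrc'0 hsrc hsrc' hrun hbox hpin hL hΛ hlo hsmall)

end Summit.QuantumFields.BalabanUV.T4Continuum.NE7PairwiseL1Sources

end
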